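import Summits.QuantumFields.YangMills.Theorems.BalabanUVNodesN12AtTheta13OfThm1CC1

/-!
# BalabanUVNodes ∕ N12 — THE COUPLING-STEP DISPLAYS OF N12's MOST-PINNED ROW FROM THE RUN's WINDOW AND THE β-SIGN LEAF (node00-def-K0a FILE 13e's one step of [I] (0.20),
# `Stage13Params.hmono_of_betaLowerH`, here `γ`-generic from dag-n12-e's module-12 lemmas) — at a generic live re-pin carrying K0b's residuals, at `θ₁₅ᶜ` and at `θ₁₅ᶜᶜ¹`; EDITION-FREE
# (Track A, DAG node N12 = [B15, Balaban1989LargeFieldI] CMP **122** (1989) 175–202; cluster K1 (K1⁗ `StabilityBAtRecordR13Sep` = stmt-QuantumFields-20290 → K1⁵ at rev 20); seat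
# `pub-ymgap-dag-n12-d` g9 (R134 s2 «knit at the record»), 2026-08-27; count-neutral, NOT a discharge)

HONEST FRAMING.  Count-neutral kernel COMPOSITION BY NAME: in 12I's ★★ window-free `Λ`-pinned row `b15Leaf_WOfRecord₁₃_pinAllΛ_N0_liveRepin₁₃_of_massLive_of_hasResiduals_of_flow` (and its
instances 12I ★★★ at `θ₁₅ᶜ`, 12L ★★★ at `θ₁₅ᶜᶜ¹`) the three displayed COUPLING-STEP inputs of the `N₀`-equation — `hgpos : 0 < g_{k′+1−N₀}`, `hgstep : g_{k′+1−N₀} ≤ g_{k′+2−N₀}`,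
`hgle : g_{k′+2−N₀} ≤ 1` (`k′ = kSel P + 1`) — are THEOREMS of (i) the run's WINDOW up to the torus `Step.InInterval γ P.K (gOfRecord₁₃ θL P)` (the very window the K1 consequent's
∃-clause speaks of; `0 < g_j ≤ γ ≤ 1`) and (ii) the β-SIGN LEAF on the window box `FlowStep.BetaLowerH b γ (betaOfRecord₁₃ θL)`, `0 ≤ b` (ANY box `]0, γ]`, `γ ≤ 1`, with the run's window in it — e.g. the K1 socket's own `(w.b, w.γ)`: `(datumOfRecord₁₃<E> θ h).βfun = betaOfRecord₁₃ θ` by def-T's `rfl` face) — the located AF input T09.F of the cell's DAG in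
exactly the currency node00-def-K0a's K0 closers (FILE 13e ∕ 14b `…_of_betaLowerH`) and the K1 sockets' β-box pair already carry — by node00-def-K0a FILE 13e's argument made `γ`-generic (`Stage13Params.hmono_of_betaLowerH` = one step of [I] (0.20) with `β ≥ 0`: dag-n12-e's
`genSeq_le_succ_of_beta_nonneg` + `betaAlongHistory_nonneg_of_betaLowerH`) and dag-n12-e's `two_le_N0OfSeq_of_hist` (`2 ≤ N₀` from `hlog`).  So N12's per-run cost list LOSES the item «coupling step» in exchange for inputs the lane
holds anyway.  Nothing of Bałaban's is asserted; the β-sign leaf is a DISPLAYED hypothesis (never asserted; [I] p.264 defers the β-function properties); every other display of 12I ∕ 12L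
stays; N12 is NOT discharged; counts unmoved (Track A discharged 5∕28).  ONE finite four-torus programme at fixed `ε = L^{-K}` — nothing continuum ∕ ℝ⁴ ∕ OS ∕ mass gap ∕ Clay.

WHAT THIS FILE GIVES (all count-neutral, EDITION-FREE):
* §1 ★★ `b15Leaf_WOfRecord₁₃_pinAllΛ_N0_liveRepin₁₃_of_massLive_of_hasResiduals_of_flow_of_betaLowerH` — 12I §1's window-free row with `hgpos hgstep hgle` REPLACED by `(hb) (hlow) (hγ1) (hI)`.
* §2 ★★★ `b15Leaf_WOfRecord₁₃_pinAllΛ_N0_theta13OfThm1C_of_massLive_of_flow_of_betaLowerH` (at `θ₁₅ᶜ`; `M = 1` discharges `0 < M`, AND the flow inputs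
  `hε0 ∕ hε1` — `0 ≤ ε_i ≤ 1∕10` — are theorems of the window there: `p₀ = 1`, `A₀ ≤ 1∕16`) and ★★★ `b15Leaf_WOfRecord₁₃_pinAllΛ_N0_theta13OfThm1CC1_of_massLive_of_flow_of_betaLowerH`
  (at `θ₁₅ᶜᶜ¹`, likewise).
WHAT N12 COSTS PER RUN AT `θ₁₅ᶜ` ∕ `θ₁₅ᶜᶜ¹` AFTER THIS FILE (kernel = §2's hypothesis lists; typing strength, NOT a second gap): live-mass at level `kSel P + 1` (NODE 00) · Prop. 1 at `λ.LF P` · the levels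
`hlog ∕ hNN ∕ hNk` · the situation's residual numbers + print's two p. 200 conditions · the (2.8a) flow relation `hflow` (NOT a theorem at `γ = ½`) · `Λ ≠ ∅` · the four ℍ-leaves +
(1.80) · the run's window up to the torus + the β-sign leaf (K0 ∕ K1's own inputs) + the witness letters' weak signs.  GONE: the coupling step `hgpos ∕ hgstep ∕ hgle` and the flow-input signs∕sizes `hε0 ∕ hε1`.

Sources: [Balaban1989LargeFieldI] (0.2)–(0.6) p.176, (1.73) p.192, Prop. 1 (1.78) p.194, (1.80) p.195, (1.88)–(1.90) pp.197–198, (1.99)–(1.102) pp.200–201, p.200 (the `N₀`-equation);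
[Balaban1987RG1] (0.17)–(0.20) pp.255–256, Thm 2 p.259, §1 p.264; [Balaban1988Convergent] (2.1)–(2.8) pp.254–256, (3.16)–(3.25) pp.268–270; [Balaban1985Variational] Thm 1 p.279 (witness letters).
-/

noncomputable section

open MeasureTheory
open scoped Matrix.Norms.L2Operator

namespace Summit.QuantumFields.YangMills.BalabanUVNodes.N12CouplingStepOfBetaSign

open Literature.MathematicalPhysics.QuantumFieldTheory.Balaban1983to89
open Literature.MathematicalPhysics.QuantumFieldTheory.Balaban1983to89.T4Continuum (T4Family)
open Literature.MathematicalPhysics.QuantumFieldTheory.Balaban1983to89.DagBinding (PrintedCarriers15 B15Leaf)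
open Literature.MathematicalPhysics.QuantumFieldTheory.Balaban1983to89.Node00
open B15Claim189Assembly (Setting189 new189 chiPP dom half)
open B15 (Prop1Printed Ineq180)
open B15.BasicStep (Claim189)
open B15.PrelimIntegrations (Ineq191 Ineq195)
open B15Chi124DetSets (E124)
open B15DeterminingSets (MSField)
open B14DomainGeom (Pt)
open B8Eq17ClassAkV1 (plaqsOf)
open GaugeGroup (dist1)
open GaugeField (plaqHol)
open B15Claim189PrintedConditions (omegaOfChain)
open B15Claim189PinsOfHistory (sitOfHist N0OfRecord₁₃ D189OfHist two_le_N0OfSeq_of_hist)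
open B15Claim189LambdaPin (enlD)
open B15Claim189FlowAtRecord (epsOfRecord_nonneg_of_inInterval)
open FlowStep (BetaLowerH)
open B15Claim189N0OfRecord (genSeq_le_succ_of_beta_nonneg betaAlongHistory_nonneg_of_betaLowerH)
open Summit.QuantumFields.YangMills.BalabanUVNodes.N12AtRecord13TermPinnedLambda (b15Leaf_WOfRecord₁₃_pinAllΛ_N0_liveRepin₁₃_of_massLive_of_hasResiduals_of_flow)

variable {N : ℕ} [NeZero N] {F : T4Family}

/-! ## §1 GENERIC `Θ` CARRYING K0b's RESIDUALS — the coupling step from the window and the β-sign leaf -/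

section Leaf
variable (Θ : Stage13Params F N) (lam : ResidW F N) (σ : ∀ P : B12.RunParams, Sit189 F N P.K)
  (s : ∀ P : B12.RunParams, SeqOfRecord F Θ.ν Θ.τ9.M (gOfRecord₁₃ F N (Θ.liveRepin₁₃ F N) P) P.K (lam.kSel P + 1)) (Nm : B12.RunParams → ℕ) (p₁ : ℕ)

/-- **★★ 12I's WINDOW-FREE `Λ`-PINNED ROW AT `θL := Θ.liveRepin₁₃` WITH THE COUPLING STEP DISCHARGED**: `hgpos ∕ hgstep ∕ hgle` of the `N₀`-equation's one step are read off the run's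
window up to the torus (`hI : 0 < g_j ≤ γ`, `j ≤ K`; `hγ1 : γ ≤ 1`) and the β-sign leaf on the box `]0, γ]` (`hlow`, `0 ≤ b`: one step of (0.20) with `β ≥ 0` gives `g_m ≤ g_{m+1}`,
`m < K` — K0a FILE 13e's `hmono_of_betaLowerH`, `γ`-generic), at the index `m = k′ + 1 − N₀ < K` (`2 ≤ N₀` from `hlog` by dag-n12-e's `two_le_N0OfSeq_of_hist`, `N₀ ≤ k′` = `hNk`).  Every other display as in 12I §1. [cite: Balaban1989LargeFieldI, (0.2)–(0.6) p.176, (1.73) p.192, Prop. 1 (1.78) p.194, (1.80) p.195, (1.88)–(1.90) pp.197–198, pp.199–201; Balaban1987RG1, (0.20) p.256, §1 p.264; Balaban1988Convergent, (2.1)–(2.8) pp.254–256, (3.16) p.268, (3.22)–(3.25) pp.269–270] -/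
theorem b15Leaf_WOfRecord₁₃_pinAllΛ_N0_liveRepin₁₃_of_massLive_of_hasResiduals_of_flow_of_betaLowerH (hres : Θ.HasResidualsOfRecord F N)
    {P : B12.RunParams} (hK : lam.kSel P < P.K) (hsh : 0 < (σ P).sh) (hM : 0 < Θ.τ9.M)
    {D : Setting189 (F.P P.K) (SU N) (MSField (F.P P.K) (SU N) × ((j : ℕ) → VecField (F.P P.K) j (EuclideanSpace ℝ (Fin (N ^ 2 - 1))))) (Pt (F.P P.K).d)}
    (hD : D = ((lam.pinRPrime₁₃ (Θ.liveRepin₁₃ F N)).pinD189ΛH (Θ.liveRepin₁₃ F N).ν (Θ.liveRepin₁₃ F N).A₁ (Θ.liveRepin₁₃ F N).τ9.M (gOfRecord₁₃ F N (Θ.liveRepin₁₃ F N)) σ s Nm p₁).D189 P)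
    (hmassLive : ∀ a, LiveSeq F N Θ.ν Θ.τ9 P (gOfRecord₁₃ F N (Θ.liveRepin₁₃ F N) P) (lam.kSel P + 1)
        (slotsTOfRecord F N Θ.ν Θ.τ9 (EOfRecord₁₃ F N (Θ.liveRepin₁₃ F N)) (wOfRecord₉ F N (Θ.liveRepin₁₃ F N).toStage9Params)
          (Θ.liveRepin₁₃ F N).ppSel P (gOfRecord₁₃ F N (Θ.liveRepin₁₃ F N) P) (lam.kSel P + 1)) a →
      0 < ∫ V, rterm (reprTOfRecord₁₃ F N (Θ.liveRepin₁₃ F N) P (lam.kSel P)) a V ∂(fieldMeasure (F.P P.K) (lam.kSel P + 1) (SU N)))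
    (hP1 : Prop1Printed (lam.LF P))
    (hlog : 1 < (Real.log (gOfRecord₁₃ F N (Θ.liveRepin₁₃ F N) P (lam.kSel P + 1) ^ 2)⁻¹) ^ Θ.ν.r)
    (hNN : N0OfRecord₁₃ (Θ.liveRepin₁₃ F N) P (lam.kSel P + 1) ≤ Nm P) (hNk : N0OfRecord₁₃ (Θ.liveRepin₁₃ F N) P (lam.kSel P + 1) ≤ lam.kSel P + 1)
    (hβ0 : 0 ≤ (σ P).β) (hβ : (σ P).β ≤ 1 / 4) (hL₀ : 2 ≤ (σ P).L₀) (hL₀L : (σ P).L₀ ^ 2 ≤ ((F.P P.K).L : ℝ))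
    (hB : 0 ≤ (σ P).O1 * (σ P).B₃ * (σ P).B₅) (hδ : 0 ≤ (σ P).δ)
    (hN₀ : (2 + (121 / 120) ^ 2 * ((σ P).O1 * (σ P).B₃ * (σ P).B₅ * (Θ.τ9.M : ℝ) ^ 5)) *
      ((((σ P).L₀ ^ 2) ^ (N0OfRecord₁₃ (Θ.liveRepin₁₃ F N) P (lam.kSel P + 1) - 1))⁻¹) ≤ 1 / 4)
    (hMl : (121 / 120) ^ 2 * ((σ P).O1 * (σ P).B₃ * (σ P).B₅ * (Θ.τ9.M : ℝ) ^ 5) * Real.exp (-(4 * (σ P).δ * (Θ.τ9.M : ℝ))) ≤ 1 / 12)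
    (hε0 : ∀ i, lam.kSel P + 1 - Nm P ≤ i → i ≤ lam.kSel P + 1 → 0 ≤ epsOfRecord Θ.ν (gOfRecord₁₃ F N (Θ.liveRepin₁₃ F N) P) i)
    (hε1 : ∀ i, lam.kSel P + 1 - Nm P ≤ i → i ≤ lam.kSel P + 1 → epsOfRecord Θ.ν (gOfRecord₁₃ F N (Θ.liveRepin₁₃ F N) P) i ≤ 1 / 10)
    {β₀ : ℝ} (hβ₀0 : 0 ≤ β₀) (hβ₀ : β₀ ≤ 1 / 2)
    (hflow : ∀ j, lam.kSel P + 1 - Nm P ≤ j → j < lam.kSel P + 1 → epsOfRecord Θ.ν (gOfRecord₁₃ F N (Θ.liveRepin₁₃ F N) P) (lam.kSel P + 1)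
      ≤ (1 + β₀) * Real.sqrt ((lam.kSel P + 1 - j : ℕ) : ℝ) * epsOfRecord Θ.ν (gOfRecord₁₃ F N (Θ.liveRepin₁₃ F N) P) j)
    -- NEW (this file): the window of the run up to the torus and the β-sign leaf on the window box REPLACE the coupling-step displays `hgpos hgstep hgle`
    {b γ : ℝ} (hb : 0 ≤ b) (hlow : BetaLowerH b γ (betaOfRecord₁₃ F N (Θ.liveRepin₁₃ F N))) (hγ1 : γ ≤ 1)
    (hI : Step.InInterval γ P.K (gOfRecord₁₃ F N (Θ.liveRepin₁₃ F N) P))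
    (hΛ : (((enlD F Θ.ν Θ.τ9.M P (gOfRecord₁₃ F N (Θ.liveRepin₁₃ F N) P)) 4 (lam.kSel P + 1 + 1 - (N0OfRecord₁₃ (Θ.liveRepin₁₃ F N) P (lam.kSel P + 1)))
        (omegaOfChain (s P) (lam.kSel P + 1 + 1 - (N0OfRecord₁₃ (Θ.liveRepin₁₃ F N) P (lam.kSel P + 1)))))ᶜ ∩ (σ P).Z).Nonempty)
    (L91h : ∀ U, new189 D U → ∀ p ∈ plaqsOf (half D),
      Ineq191 (dist1 (plaqHol (D.Upp U) p)) (D.devV'' U p) D.α ((D.L ^ D.h)⁻¹) (D.ε D.h) (E124 D.ε D.L D.η D.k D.h))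
    (L95 : ∀ U, new189 D U → ∀ p ∈ plaqsOf (half D),
      Ineq195 (D.devV'' U p) (dist1 (plaqHol (D.Uhalf U (D.boxOf p)) p)) D.α ((D.L ^ D.h)⁻¹) (D.ε D.h) (E124 D.ε D.L D.η D.k D.h))
    (L91 : ∀ U, new189 D U → ∀ j, D.h ≤ j → j ≤ D.k → ∀ p ∈ plaqsOf (dom D j),
      Ineq191 (dist1 (plaqHol (D.Upp U) p)) (D.dev97 U p) D.α ((D.L ^ j)⁻¹) (D.ε j) (E124 D.ε D.L D.η D.k j))
    (L97 : ∀ U, new189 D U → ∀ j, D.h ≤ j → j ≤ D.k → ∀ p ∈ plaqsOf (dom D j),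
      Ineq191 (D.dev97 U p) (D.dev0 U p) D.α ((D.L ^ j)⁻¹) (D.ε j) (E124 D.ε D.L D.η D.k j))
    (L80 : ∀ U, new189 D U → ∀ j, D.h ≤ j → j ≤ D.k → ∀ p ∈ plaqsOf (dom D j),
      Ineq180 (D.dev0 U p) (D.ε D.k) D.η D.B₃ D.B₅ D.M D.δ (D.dist p) D.O1) :
    B15Leaf (WOfRecord₁₃ F N (Θ.liveRepin₁₃ F N)
      ((lam.pinRPrime₁₃ (Θ.liveRepin₁₃ F N)).pinD189ΛH (Θ.liveRepin₁₃ F N).ν (Θ.liveRepin₁₃ F N).A₁ (Θ.liveRepin₁₃ F N).τ9.M (gOfRecord₁₃ F N (Θ.liveRepin₁₃ F N)) σ s Nm p₁) P) := by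
  have hN2 : 2 ≤ N0OfRecord₁₃ (Θ.liveRepin₁₃ F N) P (lam.kSel P + 1) := two_le_N0OfSeq_of_hist Θ.ν P _ hlog
  have hm : lam.kSel P + 1 + 1 - N0OfRecord₁₃ (Θ.liveRepin₁₃ F N) P (lam.kSel P + 1) < P.K := by omega
  have hidx : lam.kSel P + 1 + 1 - N0OfRecord₁₃ (Θ.liveRepin₁₃ F N) P (lam.kSel P + 1) + 1 = lam.kSel P + 1 + 2 - N0OfRecord₁₃ (Θ.liveRepin₁₃ F N) P (lam.kSel P + 1) := by omega
  -- one step of [I] (0.20) with `β ≥ b ≥ 0` at the prefix (in the box by the window): K0a FILE 13e's argument, `γ`-generic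
  have hstep := genSeq_le_succ_of_beta_nonneg (betaOfRecord₁₃ F N (Θ.liveRepin₁₃ F N)) P.g0 (hI _ hm.le).1 (hI _ hm).1
    (betaAlongHistory_nonneg_of_betaLowerH hb hlow hI _ hm)
  rw [hidx] at hstep
  exact b15Leaf_WOfRecord₁₃_pinAllΛ_N0_liveRepin₁₃_of_massLive_of_hasResiduals_of_flow Θ lam σ s Nm p₁ hres hK hsh hM hD hmassLive hP1 hlog hNN hNk hβ0 hβ hL₀ hL₀L
    hB hδ hN₀ hMl hε0 hε1 hβ₀0 hβ₀ hflow (hI _ hm.le).1 hstep ((hI _ (by omega)).2.trans hγ1) hΛ L91h L95 L91 L97 L80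

end Leaf

/-! ## §2 AT `θ₁₅ᶜ` AND AT `θ₁₅ᶜᶜ¹` -/

section Thm1C
variable (ε₀ ε₂₉ B₃ a₀ a₁ : ℝ) (lam : ResidW F N) (σ : ∀ P : B12.RunParams, Sit189 F N P.K)
  (s : ∀ P : B12.RunParams, SeqOfRecord F (theta13OfThm1C F N ε₀ ε₂₉ B₃ a₀ a₁).ν (theta13OfThm1C F N ε₀ ε₂₉ B₃ a₀ a₁).τ9.M
    (gOfRecord₁₃ F N (theta13OfThm1C F N ε₀ ε₂₉ B₃ a₀ a₁) P) P.K (lam.kSel P + 1)) (Nm : B12.RunParams → ℕ) (p₁ : ℕ)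

/-- **★★★ N12's MOST-PINNED ROW AT `θ₁₅ᶜ` WITH THE COUPLING STEP DISCHARGED** (§1 at `Θ := theta13OfNumerics … (stage12NumericsOfThm1C …) …`, whose ₁₃ live re-pin IS `θ₁₅ᶜ`; `γ = ½`
(K0a FILE 11a), `M = 1` discharges `0 < M`; the witness letters' weak signs `0 ≤ B₃, a₀, a₁` displayed): the hypothesis list of 12I's ★★★ with `hgpos hgstep hgle` REPLACED by the run's window `]0, γ]` up to
the torus (`γ ≤ 1`) and the β-sign leaf `BetaLowerH b γ (betaOfRecord₁₃ θ₁₅ᶜ)`, `0 ≤ b`; AND the flow inputs `hε0 ∕ hε1` (`0 ≤ ε_i ≤ 1∕10`) DISCHARGED from the same window (`p₀ = 1`, `A₀ ≤ 1∕16` at this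
witness: dag-n12-e's `epsOfRecord_nonneg_of_inInterval`, K0a's `epsOfRecord_le_A₀_of_p₀_eq_one` + `A0OfThm1C_le_sixteenth`) — only the (2.8a) relation `hflow` stays displayed (NOT a theorem at
`γ = ½`: [III] (2.7) smallness fails there). [cite: Balaban1989LargeFieldI, (0.2)–(0.6) p.176, (1.73) p.192, Prop. 1 (1.78) p.194, (1.80) p.195, (1.88)–(1.90) pp.197–198, pp.199–201; Balaban1987RG1, (0.20) p.256, §1 p.264; Balaban1988Convergent, (2.1)–(2.8) pp.254–256; Balaban1985Variational, Thm 1 p.279 (witness letters only)] -/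
theorem b15Leaf_WOfRecord₁₃_pinAllΛ_N0_theta13OfThm1C_of_massLive_of_flow_of_betaLowerH
    (hB₃ : 0 ≤ B₃) (ha₀ : 0 ≤ a₀) (ha₁ : 0 ≤ a₁) -- the witness letters' weak signs (for `0 ≤ A₀ᶜ ≤ 1∕16`)
    {P : B12.RunParams} (hK : lam.kSel P < P.K) (hsh : 0 < (σ P).sh)
    {D : Setting189 (F.P P.K) (SU N) (MSField (F.P P.K) (SU N) × ((j : ℕ) → VecField (F.P P.K) j (EuclideanSpace ℝ (Fin (N ^ 2 - 1))))) (Pt (F.P P.K).d)}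
    (hD : D = ((lam.pinRPrime₁₃ (theta13OfThm1C F N ε₀ ε₂₉ B₃ a₀ a₁)).pinD189ΛH (theta13OfThm1C F N ε₀ ε₂₉ B₃ a₀ a₁).ν (theta13OfThm1C F N ε₀ ε₂₉ B₃ a₀ a₁).A₁ (theta13OfThm1C F N ε₀ ε₂₉ B₃ a₀ a₁).τ9.M (gOfRecord₁₃ F N (theta13OfThm1C F N ε₀ ε₂₉ B₃ a₀ a₁)) σ s Nm p₁).D189 P)
    (hmassLive : ∀ a, LiveSeq F N (theta13OfThm1C F N ε₀ ε₂₉ B₃ a₀ a₁).ν (theta13OfThm1C F N ε₀ ε₂₉ B₃ a₀ a₁).τ9 P (gOfRecord₁₃ F N (theta13OfThm1C F N ε₀ ε₂₉ B₃ a₀ a₁) P) (lam.kSel P + 1)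
        (slotsTOfRecord F N (theta13OfThm1C F N ε₀ ε₂₉ B₃ a₀ a₁).ν (theta13OfThm1C F N ε₀ ε₂₉ B₃ a₀ a₁).τ9 (EOfRecord₁₃ F N (theta13OfThm1C F N ε₀ ε₂₉ B₃ a₀ a₁)) (wOfRecord₉ F N (theta13OfThm1C F N ε₀ ε₂₉ B₃ a₀ a₁).toStage9Params)
          (theta13OfThm1C F N ε₀ ε₂₉ B₃ a₀ a₁).ppSel P (gOfRecord₁₃ F N (theta13OfThm1C F N ε₀ ε₂₉ B₃ a₀ a₁) P) (lam.kSel P + 1)) a →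
      0 < ∫ V, rterm (reprTOfRecord₁₃ F N (theta13OfThm1C F N ε₀ ε₂₉ B₃ a₀ a₁) P (lam.kSel P)) a V ∂(fieldMeasure (F.P P.K) (lam.kSel P + 1) (SU N)))
    (hP1 : Prop1Printed (lam.LF P))
    (hlog : 1 < (Real.log (gOfRecord₁₃ F N (theta13OfThm1C F N ε₀ ε₂₉ B₃ a₀ a₁) P (lam.kSel P + 1) ^ 2)⁻¹) ^ (theta13OfThm1C F N ε₀ ε₂₉ B₃ a₀ a₁).ν.r)
    (hNN : N0OfRecord₁₃ (theta13OfThm1C F N ε₀ ε₂₉ B₃ a₀ a₁) P (lam.kSel P + 1) ≤ Nm P) (hNk : N0OfRecord₁₃ (theta13OfThm1C F N ε₀ ε₂₉ B₃ a₀ a₁) P (lam.kSel P + 1) ≤ lam.kSel P + 1)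
    (hβ0 : 0 ≤ (σ P).β) (hβ : (σ P).β ≤ 1 / 4) (hL₀ : 2 ≤ (σ P).L₀) (hL₀L : (σ P).L₀ ^ 2 ≤ ((F.P P.K).L : ℝ))
    (hB : 0 ≤ (σ P).O1 * (σ P).B₃ * (σ P).B₅) (hδ : 0 ≤ (σ P).δ)
    (hN₀ : (2 + (121 / 120) ^ 2 * ((σ P).O1 * (σ P).B₃ * (σ P).B₅ * ((theta13OfThm1C F N ε₀ ε₂₉ B₃ a₀ a₁).τ9.M : ℝ) ^ 5)) *
      ((((σ P).L₀ ^ 2) ^ (N0OfRecord₁₃ (theta13OfThm1C F N ε₀ ε₂₉ B₃ a₀ a₁) P (lam.kSel P + 1) - 1))⁻¹) ≤ 1 / 4)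
    (hMl : (121 / 120) ^ 2 * ((σ P).O1 * (σ P).B₃ * (σ P).B₅ * ((theta13OfThm1C F N ε₀ ε₂₉ B₃ a₀ a₁).τ9.M : ℝ) ^ 5) * Real.exp (-(4 * (σ P).δ * ((theta13OfThm1C F N ε₀ ε₂₉ B₃ a₀ a₁).τ9.M : ℝ))) ≤ 1 / 12)
    {β₀ : ℝ} (hβ₀0 : 0 ≤ β₀) (hβ₀ : β₀ ≤ 1 / 2)
    (hflow : ∀ j, lam.kSel P + 1 - Nm P ≤ j → j < lam.kSel P + 1 → epsOfRecord (theta13OfThm1C F N ε₀ ε₂₉ B₃ a₀ a₁).ν (gOfRecord₁₃ F N (theta13OfThm1C F N ε₀ ε₂₉ B₃ a₀ a₁) P) (lam.kSel P + 1)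
      ≤ (1 + β₀) * Real.sqrt ((lam.kSel P + 1 - j : ℕ) : ℝ) * epsOfRecord (theta13OfThm1C F N ε₀ ε₂₉ B₃ a₀ a₁).ν (gOfRecord₁₃ F N (theta13OfThm1C F N ε₀ ε₂₉ B₃ a₀ a₁) P) j)
    -- NEW (this file): the window of the run up to the torus and the β-sign leaf on the window box REPLACE the coupling-step displays `hgpos hgstep hgle`
    {b γ : ℝ} (hb : 0 ≤ b) (hlow : BetaLowerH b γ (betaOfRecord₁₃ F N (theta13OfThm1C F N ε₀ ε₂₉ B₃ a₀ a₁))) (hγ1 : γ ≤ 1)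
    (hI : Step.InInterval γ P.K (gOfRecord₁₃ F N (theta13OfThm1C F N ε₀ ε₂₉ B₃ a₀ a₁) P))
    (hΛ : (((enlD F (theta13OfThm1C F N ε₀ ε₂₉ B₃ a₀ a₁).ν (theta13OfThm1C F N ε₀ ε₂₉ B₃ a₀ a₁).τ9.M P (gOfRecord₁₃ F N (theta13OfThm1C F N ε₀ ε₂₉ B₃ a₀ a₁) P)) 4 (lam.kSel P + 1 + 1 - (N0OfRecord₁₃ (theta13OfThm1C F N ε₀ ε₂₉ B₃ a₀ a₁) P (lam.kSel P + 1)))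
        (omegaOfChain (s P) (lam.kSel P + 1 + 1 - (N0OfRecord₁₃ (theta13OfThm1C F N ε₀ ε₂₉ B₃ a₀ a₁) P (lam.kSel P + 1)))))ᶜ ∩ (σ P).Z).Nonempty)
    (L91h : ∀ U, new189 D U → ∀ p ∈ plaqsOf (half D),
      Ineq191 (dist1 (plaqHol (D.Upp U) p)) (D.devV'' U p) D.α ((D.L ^ D.h)⁻¹) (D.ε D.h) (E124 D.ε D.L D.η D.k D.h))
    (L95 : ∀ U, new189 D U → ∀ p ∈ plaqsOf (half D),
      Ineq195 (D.devV'' U p) (dist1 (plaqHol (D.Uhalf U (D.boxOf p)) p)) D.α ((D.L ^ D.h)⁻¹) (D.ε D.h) (E124 D.ε D.L D.η D.k D.h))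
    (L91 : ∀ U, new189 D U → ∀ j, D.h ≤ j → j ≤ D.k → ∀ p ∈ plaqsOf (dom D j),
      Ineq191 (dist1 (plaqHol (D.Upp U) p)) (D.dev97 U p) D.α ((D.L ^ j)⁻¹) (D.ε j) (E124 D.ε D.L D.η D.k j))
    (L97 : ∀ U, new189 D U → ∀ j, D.h ≤ j → j ≤ D.k → ∀ p ∈ plaqsOf (dom D j),
      Ineq191 (D.dev97 U p) (D.dev0 U p) D.α ((D.L ^ j)⁻¹) (D.ε j) (E124 D.ε D.L D.η D.k j))
    (L80 : ∀ U, new189 D U → ∀ j, D.h ≤ j → j ≤ D.k → ∀ p ∈ plaqsOf (dom D j),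
      Ineq180 (D.dev0 U p) (D.ε D.k) D.η D.B₃ D.B₅ D.M D.δ (D.dist p) D.O1) :
    B15Leaf (WOfRecord₁₃ F N (theta13OfThm1C F N ε₀ ε₂₉ B₃ a₀ a₁)
      ((lam.pinRPrime₁₃ (theta13OfThm1C F N ε₀ ε₂₉ B₃ a₀ a₁)).pinD189ΛH (theta13OfThm1C F N ε₀ ε₂₉ B₃ a₀ a₁).ν (theta13OfThm1C F N ε₀ ε₂₉ B₃ a₀ a₁).A₁ (theta13OfThm1C F N ε₀ ε₂₉ B₃ a₀ a₁).τ9.M (gOfRecord₁₃ F N (theta13OfThm1C F N ε₀ ε₂₉ B₃ a₀ a₁)) σ s Nm p₁) P) := by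
  have hA : 0 ≤ (theta13OfThm1C F N ε₀ ε₂₉ B₃ a₀ a₁).ν.A₀ := by rw [theta13OfThm1C_A₀]; exact A0OfThm1C_nonneg hB₃ ha₀ ha₁
  have h16 : A0OfThm1C B₃ a₀ a₁ ≤ 1 / 16 := A0OfThm1C_le_sixteenth hB₃
  have hA10 : (theta13OfThm1C F N ε₀ ε₂₉ B₃ a₀ a₁).ν.A₀ ≤ 1 / 10 := by rw [theta13OfThm1C_A₀]; linarith
  -- the flow inputs `hε0 ∕ hε1` of 12I's ★★★ are THEOREMS of the window at this witness (`p₀ = 1`, `A₀ ≤ 1∕16`): dag-n12-e's `epsOfRecord_nonneg_of_inInterval`, K0a's `epsOfRecord_le_A₀_of_p₀_eq_one`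
  have hε0 : ∀ i, lam.kSel P + 1 - Nm P ≤ i → i ≤ lam.kSel P + 1 → 0 ≤ epsOfRecord (theta13OfThm1C F N ε₀ ε₂₉ B₃ a₀ a₁).ν (gOfRecord₁₃ F N (theta13OfThm1C F N ε₀ ε₂₉ B₃ a₀ a₁) P) i :=
    fun i _ hik => epsOfRecord_nonneg_of_inInterval _ hA hγ1 hI (by omega)
  have hε1 : ∀ i, lam.kSel P + 1 - Nm P ≤ i → i ≤ lam.kSel P + 1 → epsOfRecord (theta13OfThm1C F N ε₀ ε₂₉ B₃ a₀ a₁).ν (gOfRecord₁₃ F N (theta13OfThm1C F N ε₀ ε₂₉ B₃ a₀ a₁) P) i ≤ 1 / 10 :=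
    fun i _ hik => (epsOfRecord_le_A₀_of_p₀_eq_one _ rfl hA (hI i (by omega)).1).trans hA10
  exact b15Leaf_WOfRecord₁₃_pinAllΛ_N0_liveRepin₁₃_of_massLive_of_hasResiduals_of_flow_of_betaLowerH
    (theta13OfNumerics F N (stage12NumericsOfThm1C F.L ε₀ B₃ a₀ a₁) ε₂₉
      (zeta316OfRecord F N (stage12NumericsOfThm1C F.L ε₀ B₃ a₀ a₁).ν (stage12NumericsOfThm1C F.L ε₀ B₃ a₀ a₁).τ9.M (stage12NumericsOfThm1C F.L ε₀ B₃ a₀ a₁).A₁)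
      (RzOfRecord F N) (ZtOfRecord F N)) lam σ s Nm p₁
    (hasResidualsOfRecord_theta13OfNumerics F N (stage12NumericsOfThm1C F.L ε₀ B₃ a₀ a₁) ε₂₉) hK hsh
    Nat.one_pos hD hmassLive hP1 hlog hNN hNk hβ0 hβ hL₀ hL₀L hB hδ hN₀ hMl hε0 hε1 hβ₀0 hβ₀ hflow hb hlow hγ1 hI hΛ L91h L95 L91 L97 L80

end Thm1C

section Thm1CC1
variable (ε₀ ε₂₉ B₃ B₃' a₀ a₁ : ℝ) (lam : ResidW F N) (σ : ∀ P : B12.RunParams, Sit189 F N P.K)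
  (s : ∀ P : B12.RunParams, SeqOfRecord F (theta13OfThm1CC1 F N ε₀ ε₂₉ B₃ B₃' a₀ a₁).ν (theta13OfThm1CC1 F N ε₀ ε₂₉ B₃ B₃' a₀ a₁).τ9.M
    (gOfRecord₁₃ F N (theta13OfThm1CC1 F N ε₀ ε₂₉ B₃ B₃' a₀ a₁) P) P.K (lam.kSel P + 1)) (Nm : B12.RunParams → ℕ) (p₁ : ℕ)

/-- **★★★ N12's MOST-PINNED ROW AT `θ₁₅ᶜᶜ¹` WITH THE COUPLING STEP DISCHARGED** (§1 at `Θ := theta13OfNumerics … (stage12NumericsOfThm1CC1 …) …`, whose ₁₃ live re-pin IS `θ₁₅ᶜᶜ¹`; `γ = ½`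
(K0a FILE 13a), `M = 1` discharges `0 < M`; the witness letters' weak signs `0 ≤ B₃, B₃′, a₀, a₁` displayed): the hypothesis list of 12L's ★★★ with `hgpos hgstep hgle` REPLACED by the run's window `]0, γ]`
up to the torus (`γ ≤ 1`) and the β-sign leaf `BetaLowerH b γ (betaOfRecord₁₃ θ₁₅ᶜᶜ¹)`, `0 ≤ b`; AND the flow inputs `hε0 ∕ hε1` DISCHARGED from the same window (`p₀ = 1`, `A₀ᶜᶜ¹ ≤ A₀ᶜ ≤ 1∕16`) — only
the (2.8a) relation `hflow` stays displayed. [cite: Balaban1989LargeFieldI, (0.2)–(0.6) p.176, (1.73) p.192, Prop. 1 (1.78) p.194, (1.80) p.195, (1.88)–(1.90) pp.197–198, pp.199–201; Balaban1987RG1, (0.20) p.256, §1 p.264; Balaban1988Convergent, (2.1)–(2.8) pp.254–256; Balaban1985Variational, Thm 1 p.279 (witness letters only)] -/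
theorem b15Leaf_WOfRecord₁₃_pinAllΛ_N0_theta13OfThm1CC1_of_massLive_of_flow_of_betaLowerH
    (hB₃ : 0 ≤ B₃) (hB₃' : 0 ≤ B₃') (ha₀ : 0 ≤ a₀) (ha₁ : 0 ≤ a₁) -- the witness letters' weak signs (for `0 ≤ A₀ᶜᶜ¹ ≤ A₀ᶜ ≤ 1∕16`)
    {P : B12.RunParams} (hK : lam.kSel P < P.K) (hsh : 0 < (σ P).sh)
    {D : Setting189 (F.P P.K) (SU N) (MSField (F.P P.K) (SU N) × ((j : ℕ) → VecField (F.P P.K) j (EuclideanSpace ℝ (Fin (N ^ 2 - 1))))) (Pt (F.P P.K).d)}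
    (hD : D = ((lam.pinRPrime₁₃ (theta13OfThm1CC1 F N ε₀ ε₂₉ B₃ B₃' a₀ a₁)).pinD189ΛH (theta13OfThm1CC1 F N ε₀ ε₂₉ B₃ B₃' a₀ a₁).ν (theta13OfThm1CC1 F N ε₀ ε₂₉ B₃ B₃' a₀ a₁).A₁ (theta13OfThm1CC1 F N ε₀ ε₂₉ B₃ B₃' a₀ a₁).τ9.M (gOfRecord₁₃ F N (theta13OfThm1CC1 F N ε₀ ε₂₉ B₃ B₃' a₀ a₁)) σ s Nm p₁).D189 P)
    (hmassLive : ∀ a, LiveSeq F N (theta13OfThm1CC1 F N ε₀ ε₂₉ B₃ B₃' a₀ a₁).ν (theta13OfThm1CC1 F N ε₀ ε₂₉ B₃ B₃' a₀ a₁).τ9 P (gOfRecord₁₃ F N (theta13OfThm1CC1 F N ε₀ ε₂₉ B₃ B₃' a₀ a₁) P) (lam.kSel P + 1)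
        (slotsTOfRecord F N (theta13OfThm1CC1 F N ε₀ ε₂₉ B₃ B₃' a₀ a₁).ν (theta13OfThm1CC1 F N ε₀ ε₂₉ B₃ B₃' a₀ a₁).τ9 (EOfRecord₁₃ F N (theta13OfThm1CC1 F N ε₀ ε₂₉ B₃ B₃' a₀ a₁)) (wOfRecord₉ F N (theta13OfThm1CC1 F N ε₀ ε₂₉ B₃ B₃' a₀ a₁).toStage9Params)
          (theta13OfThm1CC1 F N ε₀ ε₂₉ B₃ B₃' a₀ a₁).ppSel P (gOfRecord₁₃ F N (theta13OfThm1CC1 F N ε₀ ε₂₉ B₃ B₃' a₀ a₁) P) (lam.kSel P + 1)) a →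
      0 < ∫ V, rterm (reprTOfRecord₁₃ F N (theta13OfThm1CC1 F N ε₀ ε₂₉ B₃ B₃' a₀ a₁) P (lam.kSel P)) a V ∂(fieldMeasure (F.P P.K) (lam.kSel P + 1) (SU N)))
    (hP1 : Prop1Printed (lam.LF P))
    (hlog : 1 < (Real.log (gOfRecord₁₃ F N (theta13OfThm1CC1 F N ε₀ ε₂₉ B₃ B₃' a₀ a₁) P (lam.kSel P + 1) ^ 2)⁻¹) ^ (theta13OfThm1CC1 F N ε₀ ε₂₉ B₃ B₃' a₀ a₁).ν.r)
    (hNN : N0OfRecord₁₃ (theta13OfThm1CC1 F N ε₀ ε₂₉ B₃ B₃' a₀ a₁) P (lam.kSel P + 1) ≤ Nm P) (hNk : N0OfRecord₁₃ (theta13OfThm1CC1 F N ε₀ ε₂₉ B₃ B₃' a₀ a₁) P (lam.kSel P + 1) ≤ lam.kSel P + 1)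
    (hβ0 : 0 ≤ (σ P).β) (hβ : (σ P).β ≤ 1 / 4) (hL₀ : 2 ≤ (σ P).L₀) (hL₀L : (σ P).L₀ ^ 2 ≤ ((F.P P.K).L : ℝ))
    (hB : 0 ≤ (σ P).O1 * (σ P).B₃ * (σ P).B₅) (hδ : 0 ≤ (σ P).δ)
    (hN₀ : (2 + (121 / 120) ^ 2 * ((σ P).O1 * (σ P).B₃ * (σ P).B₅ * ((theta13OfThm1CC1 F N ε₀ ε₂₉ B₃ B₃' a₀ a₁).τ9.M : ℝ) ^ 5)) *
      ((((σ P).L₀ ^ 2) ^ (N0OfRecord₁₃ (theta13OfThm1CC1 F N ε₀ ε₂₉ B₃ B₃' a₀ a₁) P (lam.kSel P + 1) - 1))⁻¹) ≤ 1 / 4)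
    (hMl : (121 / 120) ^ 2 * ((σ P).O1 * (σ P).B₃ * (σ P).B₅ * ((theta13OfThm1CC1 F N ε₀ ε₂₉ B₃ B₃' a₀ a₁).τ9.M : ℝ) ^ 5) * Real.exp (-(4 * (σ P).δ * ((theta13OfThm1CC1 F N ε₀ ε₂₉ B₃ B₃' a₀ a₁).τ9.M : ℝ))) ≤ 1 / 12)
    {β₀ : ℝ} (hβ₀0 : 0 ≤ β₀) (hβ₀ : β₀ ≤ 1 / 2)
    (hflow : ∀ j, lam.kSel P + 1 - Nm P ≤ j → j < lam.kSel P + 1 → epsOfRecord (theta13OfThm1CC1 F N ε₀ ε₂₉ B₃ B₃' a₀ a₁).ν (gOfRecord₁₃ F N (theta13OfThm1CC1 F N ε₀ ε₂₉ B₃ B₃' a₀ a₁) P) (lam.kSel P + 1)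
      ≤ (1 + β₀) * Real.sqrt ((lam.kSel P + 1 - j : ℕ) : ℝ) * epsOfRecord (theta13OfThm1CC1 F N ε₀ ε₂₉ B₃ B₃' a₀ a₁).ν (gOfRecord₁₃ F N (theta13OfThm1CC1 F N ε₀ ε₂₉ B₃ B₃' a₀ a₁) P) j)
    -- NEW (this file): the window of the run up to the torus and the β-sign leaf on the window box REPLACE the coupling-step displays `hgpos hgstep hgle`
    {b γ : ℝ} (hb : 0 ≤ b) (hlow : BetaLowerH b γ (betaOfRecord₁₃ F N (theta13OfThm1CC1 F N ε₀ ε₂₉ B₃ B₃' a₀ a₁))) (hγ1 : γ ≤ 1)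
    (hI : Step.InInterval γ P.K (gOfRecord₁₃ F N (theta13OfThm1CC1 F N ε₀ ε₂₉ B₃ B₃' a₀ a₁) P))
    (hΛ : (((enlD F (theta13OfThm1CC1 F N ε₀ ε₂₉ B₃ B₃' a₀ a₁).ν (theta13OfThm1CC1 F N ε₀ ε₂₉ B₃ B₃' a₀ a₁).τ9.M P (gOfRecord₁₃ F N (theta13OfThm1CC1 F N ε₀ ε₂₉ B₃ B₃' a₀ a₁) P)) 4 (lam.kSel P + 1 + 1 - (N0OfRecord₁₃ (theta13OfThm1CC1 F N ε₀ ε₂₉ B₃ B₃' a₀ a₁) P (lam.kSel P + 1)))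
        (omegaOfChain (s P) (lam.kSel P + 1 + 1 - (N0OfRecord₁₃ (theta13OfThm1CC1 F N ε₀ ε₂₉ B₃ B₃' a₀ a₁) P (lam.kSel P + 1)))))ᶜ ∩ (σ P).Z).Nonempty)
    (L91h : ∀ U, new189 D U → ∀ p ∈ plaqsOf (half D),
      Ineq191 (dist1 (plaqHol (D.Upp U) p)) (D.devV'' U p) D.α ((D.L ^ D.h)⁻¹) (D.ε D.h) (E124 D.ε D.L D.η D.k D.h))
    (L95 : ∀ U, new189 D U → ∀ p ∈ plaqsOf (half D),
      Ineq195 (D.devV'' U p) (dist1 (plaqHol (D.Uhalf U (D.boxOf p)) p)) D.α ((D.L ^ D.h)⁻¹) (D.ε D.h) (E124 D.ε D.L D.η D.k D.h))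
    (L91 : ∀ U, new189 D U → ∀ j, D.h ≤ j → j ≤ D.k → ∀ p ∈ plaqsOf (dom D j),
      Ineq191 (dist1 (plaqHol (D.Upp U) p)) (D.dev97 U p) D.α ((D.L ^ j)⁻¹) (D.ε j) (E124 D.ε D.L D.η D.k j))
    (L97 : ∀ U, new189 D U → ∀ j, D.h ≤ j → j ≤ D.k → ∀ p ∈ plaqsOf (dom D j),
      Ineq191 (D.dev97 U p) (D.dev0 U p) D.α ((D.L ^ j)⁻¹) (D.ε j) (E124 D.ε D.L D.η D.k j))
    (L80 : ∀ U, new189 D U → ∀ j, D.h ≤ j → j ≤ D.k → ∀ p ∈ plaqsOf (dom D j),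
      Ineq180 (D.dev0 U p) (D.ε D.k) D.η D.B₃ D.B₅ D.M D.δ (D.dist p) D.O1) :
    B15Leaf (WOfRecord₁₃ F N (theta13OfThm1CC1 F N ε₀ ε₂₉ B₃ B₃' a₀ a₁)
      ((lam.pinRPrime₁₃ (theta13OfThm1CC1 F N ε₀ ε₂₉ B₃ B₃' a₀ a₁)).pinD189ΛH (theta13OfThm1CC1 F N ε₀ ε₂₉ B₃ B₃' a₀ a₁).ν (theta13OfThm1CC1 F N ε₀ ε₂₉ B₃ B₃' a₀ a₁).A₁ (theta13OfThm1CC1 F N ε₀ ε₂₉ B₃ B₃' a₀ a₁).τ9.M (gOfRecord₁₃ F N (theta13OfThm1CC1 F N ε₀ ε₂₉ B₃ B₃' a₀ a₁)) σ s Nm p₁) P) := by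
  have hA : 0 ≤ (theta13OfThm1CC1 F N ε₀ ε₂₉ B₃ B₃' a₀ a₁).ν.A₀ := by rw [theta13OfThm1CC1_A₀]; exact A0OfThm1CC1_nonneg hB₃ hB₃' ha₀ ha₁
  have h16 : A0OfThm1CC1 F.L B₃ B₃' a₀ a₁ ≤ 1 / 16 := (A0OfThm1CC1_le hB₃ hB₃' ha₀ ha₁).trans (A0OfThm1C_le_sixteenth hB₃)
  have hA10 : (theta13OfThm1CC1 F N ε₀ ε₂₉ B₃ B₃' a₀ a₁).ν.A₀ ≤ 1 / 10 := by rw [theta13OfThm1CC1_A₀]; linarith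
  -- the flow inputs `hε0 ∕ hε1` of 12L's ★★★ are THEOREMS of the window at this witness (`p₀ = 1`, `A₀ᶜᶜ¹ ≤ A₀ᶜ ≤ 1∕16`)
  have hε0 : ∀ i, lam.kSel P + 1 - Nm P ≤ i → i ≤ lam.kSel P + 1 → 0 ≤ epsOfRecord (theta13OfThm1CC1 F N ε₀ ε₂₉ B₃ B₃' a₀ a₁).ν (gOfRecord₁₃ F N (theta13OfThm1CC1 F N ε₀ ε₂₉ B₃ B₃' a₀ a₁) P) i :=
    fun i _ hik => epsOfRecord_nonneg_of_inInterval _ hA hγ1 hI (by omega)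
  have hε1 : ∀ i, lam.kSel P + 1 - Nm P ≤ i → i ≤ lam.kSel P + 1 → epsOfRecord (theta13OfThm1CC1 F N ε₀ ε₂₉ B₃ B₃' a₀ a₁).ν (gOfRecord₁₃ F N (theta13OfThm1CC1 F N ε₀ ε₂₉ B₃ B₃' a₀ a₁) P) i ≤ 1 / 10 :=
    fun i _ hik => (epsOfRecord_le_A₀_of_p₀_eq_one _ rfl hA (hI i (by omega)).1).trans hA10
  exact b15Leaf_WOfRecord₁₃_pinAllΛ_N0_liveRepin₁₃_of_massLive_of_hasResiduals_of_flow_of_betaLowerH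
    (theta13OfNumerics F N (stage12NumericsOfThm1CC1 F.L ε₀ B₃ B₃' a₀ a₁) ε₂₉
      (zeta316OfRecord F N (stage12NumericsOfThm1CC1 F.L ε₀ B₃ B₃' a₀ a₁).ν (stage12NumericsOfThm1CC1 F.L ε₀ B₃ B₃' a₀ a₁).τ9.M (stage12NumericsOfThm1CC1 F.L ε₀ B₃ B₃' a₀ a₁).A₁)
      (RzOfRecord F N) (ZtOfRecord F N)) lam σ s Nm p₁
    (hasResidualsOfRecord_theta13OfNumerics F N (stage12NumericsOfThm1CC1 F.L ε₀ B₃ B₃' a₀ a₁) ε₂₉) hK hsh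
    Nat.one_pos hD hmassLive hP1 hlog hNN hNk hβ0 hβ hL₀ hL₀L hB hδ hN₀ hMl hε0 hε1 hβ₀0 hβ₀ hflow hb hlow hγ1 hI hΛ L91h L95 L91 L97 L80

end Thm1CC1

end Summit.QuantumFields.YangMills.BalabanUVNodes.N12CouplingStepOfBetaSign
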